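import Summits.BirchSwinnertonDyer.BirchSwinnertonDyer.Theorems.PrintX11aUpperNonSurjFiveUnitSector
import Summits.BirchSwinnertonDyer.BirchSwinnertonDyer.Theorems.PrintX11aNonSurjMuAnHardDefs
import Summits.BirchSwinnertonDyer.BirchSwinnertonDyer.Theorems.KatoDescentTamePotSupersingularCartanMuRoadFukudaDoorsTprime
import Summits.BirchSwinnertonDyer.BirchSwinnertonDyer.Theses.PrintX11a
import HarnessLib

/-!
# Route `PrintX11a`, crux U5 = `Theses.PrintX11a.UpperNonSurjFive` (item stmt-BirchSwinnertonDyer-20614), line of record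
# «gl1cartan5»: the UNIT SECTOR of U5 is served BY NAME by the tree's μ-road fold-in, so the open residuals of the record
# (rev 8: R′ exponent term, R₁′ Tamagawa term) are CUT TO THEIR NON-UNIT CORES R′♭ / R₁′♭ — glue, exactness, comparison
# with rev 8 and with the rung of line «finemu5»; and the headline of line «cmvalue5» REV 4 as a corollary of tree theorems

Cell `bsd-print-x11a`, LEAD `cruxlead-stmt-BirchSwinnertonDyer-20614` g4 (integration of the evidence on item 20614 at the g4
re-seat: line «cmvalue5» REV 4, bsd-idea-6 g9, evidence #51–54).  THEOREMS ONLY: no definition, no named fact minted, no `sorry`;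
every theorem is CONDITIONAL on named published facts displayed as hypotheses and/or on the open residual statements; item 20614 is
NOT closed by this file and nothing is asserted about any curve.

THE POINT.  At a NON-split multiplicative `p` with `L(E,1)/Ω_E` a `p`-adic unit, the constant coefficient `2·L(E,1)/Ω_E` of the
Néron-normalised Mazur–Tate–Teitelbaum function `ϖ·L_p(f_E)` is a `p`-adic unit, i.e. the analytic `μ`-certificate holds at level `0`
(`MuAnUnit.exists_norm_coeff_eq_one_of_neg_one_of_padicValRat_eq_zero`); the cell's μ-road then gives the Euler half
`Typed.MissingUpperBoundAt W p` WITHOUT big image, modulo EIGHT print-exact named facts (Stein–Wuthrich 2013 Thm. 6.1 ×2, Kato 2004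
Thm. 12.4, modularity, Kato §17.13 construction facts V′ ∕ VI′ ∕ XI′, Mazur 1978 Cor. 4.1) — this is the «easy locus folded in» of
`ClassX11a.missingUpperBoundAt_of_not_surj_of_hardCert_of_nineFacts` (x11a-p3 g6, `Theorems/PrintX11aUpperNonSurjFiveOfNineFacts.lean`;
first landed as `x11a_missingUpperBoundAt_of_not_surj_of_nonsplit_of_unit_value`, p539522 §6).  Consequently:

* (companion route-file-free module `Theorems/PrintX11aUpperNonSurjFiveUnitSector.lean`, same seat) the UNIT SECTOR of U5
  («`p` non-split, `ord_p (L(E,1)/Ω_E) = 0`») closed class-free modulo the eight facts (`GL1Cartan.upperNonSurjFive_on_unitSector_of_eightFacts`),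
  the `μ`-certificate door with the certificate explicit (`ClassX11a.missingUpperBoundAt_of_not_surj_of_muCert_contra`), and the HEADLINE of
  line «cmvalue5» REV 4 (`UnitSectorNoPTorsion`: main locus ∧ `p ∤ #Ш_an` ⟹ `Ш(E/ℚ)[p] = 0`) as a corollary on the larger locus «no split
  multiplicative prime ∧ `p ∤ #Ш_an`» (`GL1Cartan.noPTorsion_on_unitSector_of_nineFacts`) — no CM value transport, no twist-existence stub.
* §0 `unitSectorNoPTorsion_cmvalue5_of_nineFacts` — the cmvalue5 headline in its LITERAL binder shape (main locus, unused «no `ℓ ≡ −1`» binder,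
  `ord_p #Ш_an ≤ 0`), from the companion module: eight facts + GZK, nothing else.
* §1 the record's residuals CUT TO THEIR NON-UNIT CORES (hard locus of the μ-road = «`p` split, or `ord_p (L(E,1)/Ω_E) ≠ 0`», the
  verbatim antecedent of the rung `Theorems.X11aNonSurjMuAnHardFive`):
    R′♭  = «X11a, `¬ Surj`, `p ≥ 5`, no split multiplicative prime, `Ш(E)[p] ≠ 0`, `ord_p (L(E,1)/Ω_E) ≠ 0` ⇒ `MissingUpperBoundAt W p`»
           (the EXPONENT core: an integral Euler-system bound of exponent `≥ 1` at mod-`p` image `N(C_s)`/`5S4`; census = the 15 twist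
           pairs of `R2-CENSUS-cruxlead-g2.md`, all with `25 ∣ #Ш_an`),
    R₁′♭ = «X11a, `¬ Surj`, `p ≥ 5`, some split multiplicative prime, hard locus ⇒ `MissingUpperBoundAt W p`» (the TAMAGAWA ∕
           exceptional-zero core; BSD predicts the hard-locus clause is automatic here since `p ∣ c_ℓ` at a split multiplicative `ℓ`),
  with the fact-free glue `upperNonSurjFive_of_unitSector_of_sector_of_coreResiduals` (UNIT → SECTOR′ → R′♭ → R₁′♭ → U5 BY NAME, a case
  split) and the facts-inlined glue `upperNonSurjFive_of_nineFacts_of_coreResiduals` (eight facts + GZK → R′♭ → R₁′♭ → U5).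
* §2 exactness `upperNonSurjFive_iff_unitSector_and_sector_and_coreResiduals` (fact-free) and the comparisons: rev 8 ⇒ cores
  (`coreResiduals_of_arithResiduals`, weakening), cores ⇒ rev 8 modulo the nine facts (`arithResiduals_of_nineFacts_of_coreResiduals`),
  and **rung of «finemu5» ⇒ cores** (`coreResiduals_of_muAnHardFive_of_nineFacts`: Greenberg's analytic `μ = 0` on the hard locus
  implies both cores, modulo the eight facts + Greenberg–Stevens) — the record line asks NO MORE of the future than the μ-line, and strictly less
  (no `μ`-statement is needed where `Ш(E)[p] = 0`).

HONEST FRAMING.  The two cores are U5 VERBATIM on sub-loci (open research; the common wall of every line on this crux: barrier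
`EulerSystemBigImageAtSmallImage`, Greenberg's `μ`-conjecture for irreducible `E[p]`).  The leaf `ClassX11a` is not closed; no statement
of the summit is proved; BSD is not proved by any of this and nothing here bounds a non-trivial `Ш`.  «beyond-print theorem: NO»
(re-plumbing of landed theorems; the named facts are displayed, not discharged).

References: [MazurTateTeitelbaum1986] §I.10, §I.14 (constant term at a non-split prime); [Kato2004Asterisque] Thm. 12.4 (p. 221), §17.13
(pp. 279–280); [SteinWuthrich2013] Thm. 6.1 (p. 20); [Wuthrich2014] Cor. 18 (p. 398); [Mazur1978] Cor. 4.1; [Mazur1977] Ch. III §5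
(p. 157); [Miller2011LMS] Def. 1.1 (arXiv:1010.2431 p. 3); [GreenbergLNM1716] §1 Conj. 1.11 (p. 62); [SilvermanATAEC1994] Cor. IV.9.2 (d);
tree `Theorems/PrintX11aUpperNonSurjFiveUnitSector.lean` (this seat), `Theorems/PrintX11aUpperNonSurjFiveOfNineFacts.lean` (x11a-p3 g6),
`Theorems/PrintX11aUpperNonSurjFiveNoPTorsionSector.lean` (p668359),
`Cruxes/UpperNonSurjFive/Lines/gl1cartan5.lean` (rev 8), `Cruxes/UpperNonSurjFive/Lines/cmvalue5.lean` (REV 4, bsd-idea-6 g9).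
-/

-- justified: the file namespace `Summit.BirchSwinnertonDyer.BirchSwinnertonDyer.Theorems.GL1Cartan` repeats the sub-problem segment by the D-0017 layout
set_option linter.dupNamespace false
set_option autoImplicit false

noncomputable section

open scoped Classical NumberField MatrixGroups ModularForm

open CongruenceSubgroup WeierstrassCurve
  Literature.NumberTheory.EllipticCurves
  Literature.NumberTheory.EllipticCurves.ModularForms
  Literature.NumberTheory.EllipticCurves.Rank1Residual
  Literature.NumberTheory.EllipticCurves.Rank1Residual.Typed
  Literature.NumberTheory.EllipticCurves.SteinWuthrich2013
  Literature.NumberTheory.EllipticCurves.Kato2004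
  Literature.NumberTheory.EllipticCurves.Wuthrich2014
  Literature.NumberTheory.SerreUniformity
  Summit.BirchSwinnertonDyer.Rank1Residual
  Summit.BirchSwinnertonDyer.BirchSwinnertonDyer.Theses

namespace Summit.BirchSwinnertonDyer.BirchSwinnertonDyer.Theorems.GL1Cartan

/-! ## §0 The headline of line «cmvalue5» REV 4 in its literal binder shape (corollary of the companion module) -/

/-- **`UnitSectorNoPTorsion` of line «cmvalue5» REV 4, LITERAL binder shape, from tree theorems (CONDITIONAL on eight print facts +
Gross–Zagier–Kolyvagin).**  For minimal `E/ℚ` in class X11a with `5 ≤ p`, on the MAIN LOCUS, with no multiplicative `ℓ ≡ −1 (mod p)` (this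
binder is NOT used) and `#Ш_an = q` with `ord_p q ≤ 0`: `Ш(E/ℚ)[p] = 0`.  The main locus gives `¬ Surj W p` (a split-Cartan-normaliser image is not
surjective, `CartanMuRoadFukudaDoorsTprime.not_hasSurjectiveModNGaloisRep_of_hasSplitCartanNormalizerModPImage`) and «no split multiplicative
prime» (`not_hasSplitMultiplicativeReductionAtPrime_of_mainLocus`); integrality `0 ≤ ord_p #Ш_an` (`shaAnIntegral_of_mazur`) upgrades `≤ 0` to `= 0`;
then `noPTorsion_on_unitSector_of_nineFacts`.  So the cmvalue5 headline needs no CM companion, no CM value transport and no twist-existence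
stub — only the μ-road's eight facts + GZK. [cite: MazurTateTeitelbaum1986, §I.10 and §I.14] [cite: Kato2004Asterisque, §17.13 (pp. 279–280)]
[cite: Serre1972, §2.2] [cite: Miller2011LMS, Def. 1.1 (arXiv:1010.2431 p. 3)] -/
theorem unitSectorNoPTorsion_cmvalue5_of_nineFacts
    (hJs : thm61_splitMultiplicative) (hJn : thm61_nonsplitMultiplicative)
    (h12 : Kato2004.thm12_4) (hnf : exists_isNewformOf)
    (hns' : Kato2004.exists_multDivisibilityInputs_nonsplit_contra)
    (hsp' : Kato2004.exists_multDivisibilityInputs_split_contra)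
    (hfine' : Kato2004.exists_multDivisibilityInputs_fine_contra) (hMz : mazur_not_dvd_maninConstant_of_odd)
    (hGZK : rank_eq_analyticRank_of_analyticRank_le_one) :
    ∀ (W : WeierstrassCurve ℚ) [W.IsElliptic] [W.IsGloballyMinimal] (p : ℕ) [Fact p.Prime],
      ClassX11a W p → 5 ≤ p → MainLocus W p →
      (∀ (ℓ : ℕ) [Fact ℓ.Prime], ℓ ≠ p → W.HasMultiplicativeReductionAtPrime ℓ → ¬ p ∣ ℓ + 1) →
      (∃ q : ℚ, shaAn W = (q : ℂ) ∧ padicValRat p q ≤ 0) → ∀ x : W.sha, (p : ℤ) • x = 0 → x = 0 := by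
  intro W _ _ p _ hX hp5 hL _hℓ hq
  have hns : ¬ Surj W p :=
    CartanMuRoadFukudaDoorsTprime.not_hasSurjectiveModNGaloisRep_of_hasSplitCartanNormalizerModPImage W hL.1
  have hnsm : ∀ (ℓ : ℕ) [Fact ℓ.Prime], ¬ W.HasSplitMultiplicativeReductionAtPrime ℓ :=
    fun ℓ _ => not_hasSplitMultiplicativeReductionAtPrime_of_mainLocus hL ℓ
  obtain ⟨q, hq, hle⟩ := hq
  obtain ⟨q', hq', hge⟩ := shaAnIntegral_of_mazur hnf hMz hGZK W p hX hp5 hnsm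
  have hqq : q' = q := by exact_mod_cast hq'.symm.trans hq
  subst hqq
  exact noPTorsion_on_unitSector_of_nineFacts hJs hJn h12 hnf hns' hsp' hfine' hMz hGZK W p hX hns hp5 hnsm
    ⟨q', hq', le_antisymm hle hge⟩

/-! ## §1 The record's residuals cut to their NON-UNIT cores, and the glue to the crux BY NAME -/

/-- **Glue, shape A♭ (fact-free): UNIT → SECTOR′ → R′♭ → R₁′♭ → U5.**  If U5's conclusion `MissingUpperBoundAt W p` holds (i) on the unit
sector («`p` non-split, `ord_p (L(E,1)/Ω_E) = 0`»; served by `upperNonSurjFive_on_unitSector_of_eightFacts`), (ii) wherever no prime is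
split multiplicative and `Ш(E)[p] = 0` (SECTOR′; served by `upperNonSurjFive_on_noPTorsion_of_noSplitMult` modulo three prints), (iii) on
the EXPONENT core R′♭ («no split multiplicative prime, `Ш(E)[p] ≠ 0`, `ord_p (L(E,1)/Ω_E) ≠ 0`») and (iv) on the TAMAGAWA core R₁′♭ («some
split multiplicative prime, and `p` split or `ord_p (L(E,1)/Ω_E) ≠ 0`»), then U5 = `Theses.PrintX11a.UpperNonSurjFive` holds: a case split
on the hard locus «`p` split ∨ `∀ t, L(E,1)/Ω_E = t → ord_p t ≠ 0`», then on «some split multiplicative prime», then on «`Ш(E)[p] = 0`».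
None of the four hypotheses is discharged here. [cite: Miller2011LMS, Def. 1.1 (shape of the halves)] -/
theorem upperNonSurjFive_of_unitSector_of_sector_of_coreResiduals
    (hU : ∀ (W : WeierstrassCurve ℚ) [W.IsElliptic] [W.IsGloballyMinimal] (p : ℕ) [Fact p.Prime],
      ClassX11a W p → ¬ Surj W p → 5 ≤ p → ¬ W.HasSplitMultiplicativeReductionAtPrime p →
      (∃ t : ℚ, W.entireLFunction 1 / (W.realPeriodRat : ℂ) = (t : ℂ) ∧ padicValRat p t = 0) →
      MissingUpperBoundAt W p)
    (hS' : ∀ (W : WeierstrassCurve ℚ) [W.IsElliptic] [W.IsGloballyMinimal] (p : ℕ) [Fact p.Prime],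
      ClassX11a W p → ¬ Surj W p → 5 ≤ p → (∀ (ℓ : ℕ) [Fact ℓ.Prime], ¬ W.HasSplitMultiplicativeReductionAtPrime ℓ) →
      (∀ x : W.sha, (p : ℤ) • x = 0 → x = 0) → MissingUpperBoundAt W p)
    (hC' : ∀ (W : WeierstrassCurve ℚ) [W.IsElliptic] [W.IsGloballyMinimal] (p : ℕ) [Fact p.Prime],
      ClassX11a W p → ¬ Surj W p → 5 ≤ p → (∀ (ℓ : ℕ) [Fact ℓ.Prime], ¬ W.HasSplitMultiplicativeReductionAtPrime ℓ) →
      (∃ x : W.sha, (p : ℤ) • x = 0 ∧ x ≠ 0) →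
      (∀ t : ℚ, W.entireLFunction 1 / (W.realPeriodRat : ℂ) = (t : ℂ) → padicValRat p t ≠ 0) →
      MissingUpperBoundAt W p)
    (hC₁' : ∀ (W : WeierstrassCurve ℚ) [W.IsElliptic] [W.IsGloballyMinimal] (p : ℕ) [Fact p.Prime],
      ClassX11a W p → ¬ Surj W p → 5 ≤ p →
      (∃ (ℓ : ℕ) (_ : Fact ℓ.Prime), W.HasSplitMultiplicativeReductionAtPrime ℓ) →
      (W.HasSplitMultiplicativeReductionAtPrime p ∨
        ∀ t : ℚ, W.entireLFunction 1 / (W.realPeriodRat : ℂ) = (t : ℂ) → padicValRat p t ≠ 0) →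
      MissingUpperBoundAt W p) :
    PrintX11a.UpperNonSurjFive := by
  intro W _ _ p _ hX hns hp5
  by_cases hhard : W.HasSplitMultiplicativeReductionAtPrime p ∨
      ∀ t : ℚ, W.entireLFunction 1 / (W.realPeriodRat : ℂ) = (t : ℂ) → padicValRat p t ≠ 0
  · -- on the hard locus of the μ-road
    by_cases hsm : ∃ (ℓ : ℕ) (_ : Fact ℓ.Prime), W.HasSplitMultiplicativeReductionAtPrime ℓ
    · exact hC₁' W p hX hns hp5 hsm hhard
    · have hnsm : ∀ (ℓ : ℕ) [Fact ℓ.Prime], ¬ W.HasSplitMultiplicativeReductionAtPrime ℓ :=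
        fun ℓ hℓ h => hsm ⟨ℓ, hℓ, h⟩
      have hval : ∀ t : ℚ, W.entireLFunction 1 / (W.realPeriodRat : ℂ) = (t : ℂ) → padicValRat p t ≠ 0 :=
        hhard.resolve_left (hnsm p)
      by_cases hSha : ∀ x : W.sha, (p : ℤ) • x = 0 → x = 0
      · exact hS' W p hX hns hp5 hnsm hSha
      · push Not at hSha
        exact hC' W p hX hns hp5 hnsm hSha hval
  · -- off the hard locus: `p` non-split and `L(E,1)/Ω_E = t` with `ord_p t = 0` — the unit sector
    simp only [not_or, not_forall, not_not] at hhard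
    obtain ⟨hnsp, t, ht, hunit⟩ := hhard
    exact hU W p hX hns hp5 hnsp ⟨t, ht, hunit⟩

/-- **Glue, shape B♭ (sectors inlined): eight print-exact facts + Gross–Zagier–Kolyvagin → R′♭ → R₁′♭ → U5.**  The unit sector is §1
(Stein–Wuthrich 6.1 ×2, Kato 12.4, modularity, Kato §17.13 V′ ∕ VI′ ∕ XI′, Mazur Cor. 4.1) and SECTOR′ is
`upperNonSurjFive_on_noPTorsion_of_noSplitMult` (GZK, modularity, Mazur); so U5 holds granted NINE named print facts and the two NON-UNIT
cores.  CONDITIONAL (credits nothing): R′♭ and R₁′♭ are open.  This is the composition of the registered skeleton rev 9 of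
`Cruxes/UpperNonSurjFive/Lines/gl1cartan5.lean`. [cite: Kato2004Asterisque, Thm. 12.4 (p. 221) and §17.13 (pp. 279–280)]
[cite: SteinWuthrich2013, Thm. 6.1 (p. 20)] [cite: Mazur1978, Cor. 4.1] [cite: Miller2011LMS, Def. 1.1] -/
theorem upperNonSurjFive_of_nineFacts_of_coreResiduals
    (hJs : thm61_splitMultiplicative) (hJn : thm61_nonsplitMultiplicative)
    (h12 : Kato2004.thm12_4) (hnf : exists_isNewformOf)
    (hns' : Kato2004.exists_multDivisibilityInputs_nonsplit_contra)
    (hsp' : Kato2004.exists_multDivisibilityInputs_split_contra)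
    (hfine' : Kato2004.exists_multDivisibilityInputs_fine_contra) (hMz : mazur_not_dvd_maninConstant_of_odd)
    (hGZK : rank_eq_analyticRank_of_analyticRank_le_one)
    (hC' : ∀ (W : WeierstrassCurve ℚ) [W.IsElliptic] [W.IsGloballyMinimal] (p : ℕ) [Fact p.Prime],
      ClassX11a W p → ¬ Surj W p → 5 ≤ p → (∀ (ℓ : ℕ) [Fact ℓ.Prime], ¬ W.HasSplitMultiplicativeReductionAtPrime ℓ) →
      (∃ x : W.sha, (p : ℤ) • x = 0 ∧ x ≠ 0) →
      (∀ t : ℚ, W.entireLFunction 1 / (W.realPeriodRat : ℂ) = (t : ℂ) → padicValRat p t ≠ 0) →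
      MissingUpperBoundAt W p)
    (hC₁' : ∀ (W : WeierstrassCurve ℚ) [W.IsElliptic] [W.IsGloballyMinimal] (p : ℕ) [Fact p.Prime],
      ClassX11a W p → ¬ Surj W p → 5 ≤ p →
      (∃ (ℓ : ℕ) (_ : Fact ℓ.Prime), W.HasSplitMultiplicativeReductionAtPrime ℓ) →
      (W.HasSplitMultiplicativeReductionAtPrime p ∨
        ∀ t : ℚ, W.entireLFunction 1 / (W.realPeriodRat : ℂ) = (t : ℂ) → padicValRat p t ≠ 0) →
      MissingUpperBoundAt W p) :
    PrintX11a.UpperNonSurjFive :=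
  upperNonSurjFive_of_unitSector_of_sector_of_coreResiduals
    (upperNonSurjFive_on_unitSector_of_eightFacts hJs hJn h12 hnf hns' hsp' hfine' hMz)
    (fun W _ _ p _ hX _ hp5 hnsm hSha => by
      -- SECTOR′ (landed as `upperNonSurjFive_on_noPTorsion_of_noSplitMult`, p668359): `#Ш_an ∈ ℤ_(p)` by the bridge, then the door
      obtain ⟨q, hq, hv⟩ := shaAnIntegral_of_mazur hnf hMz hGZK W p hX hp5 hnsm
      exact hX.missingUpperBoundAt_of_noPTorsion hGZK hq hv hSha)
    hC' hC₁'

/-! ## §2 Exactness of the cut, and comparison with rev 8 and with the rung of line «finemu5» -/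

/-- U5 gives the unit-sector statement back (restriction). [cite: Miller2011LMS, Def. 1.1] -/
theorem unitSector_of_upperNonSurjFive (h : PrintX11a.UpperNonSurjFive) :
    ∀ (W : WeierstrassCurve ℚ) [W.IsElliptic] [W.IsGloballyMinimal] (p : ℕ) [Fact p.Prime],
      ClassX11a W p → ¬ Surj W p → 5 ≤ p → ¬ W.HasSplitMultiplicativeReductionAtPrime p →
      (∃ t : ℚ, W.entireLFunction 1 / (W.realPeriodRat : ℂ) = (t : ℂ) ∧ padicValRat p t = 0) →
      MissingUpperBoundAt W p :=
  fun W _ _ p _ hX hns hp5 _ _ => h W p hX hns hp5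

/-- U5 gives the exponent core R′♭ back (restriction). [cite: Miller2011LMS, Def. 1.1] -/
theorem pTorsionCore_of_upperNonSurjFive (h : PrintX11a.UpperNonSurjFive) :
    ∀ (W : WeierstrassCurve ℚ) [W.IsElliptic] [W.IsGloballyMinimal] (p : ℕ) [Fact p.Prime],
      ClassX11a W p → ¬ Surj W p → 5 ≤ p → (∀ (ℓ : ℕ) [Fact ℓ.Prime], ¬ W.HasSplitMultiplicativeReductionAtPrime ℓ) →
      (∃ x : W.sha, (p : ℤ) • x = 0 ∧ x ≠ 0) →
      (∀ t : ℚ, W.entireLFunction 1 / (W.realPeriodRat : ℂ) = (t : ℂ) → padicValRat p t ≠ 0) →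
      MissingUpperBoundAt W p :=
  fun W _ _ p _ hX hns hp5 _ _ _ => h W p hX hns hp5

/-- U5 gives the Tamagawa core R₁′♭ back (restriction). [cite: Miller2011LMS, Def. 1.1] -/
theorem splitMultCore_of_upperNonSurjFive (h : PrintX11a.UpperNonSurjFive) :
    ∀ (W : WeierstrassCurve ℚ) [W.IsElliptic] [W.IsGloballyMinimal] (p : ℕ) [Fact p.Prime],
      ClassX11a W p → ¬ Surj W p → 5 ≤ p →
      (∃ (ℓ : ℕ) (_ : Fact ℓ.Prime), W.HasSplitMultiplicativeReductionAtPrime ℓ) →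
      (W.HasSplitMultiplicativeReductionAtPrime p ∨
        ∀ t : ℚ, W.entireLFunction 1 / (W.realPeriodRat : ℂ) = (t : ℂ) → padicValRat p t ≠ 0) →
      MissingUpperBoundAt W p :=
  fun W _ _ p _ hX hns hp5 _ _ => h W p hX hns hp5

/-- **Exactness of the cut (fact-free): U5 ↔ UNIT ∧ SECTOR′ ∧ R′♭ ∧ R₁′♭.**  The crux `Theses.PrintX11a.UpperNonSurjFive` is EQUIVALENT
to the conjunction of the unit-sector statement, the no-`p`-torsion sector statement and the two non-unit cores — a glued split of item
20614 into these four children (the first two served modulo named prints, the last two open) is lossless. [cite: Miller2011LMS, Def. 1.1] -/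
theorem upperNonSurjFive_iff_unitSector_and_sector_and_coreResiduals :
    PrintX11a.UpperNonSurjFive ↔
      ((∀ (W : WeierstrassCurve ℚ) [W.IsElliptic] [W.IsGloballyMinimal] (p : ℕ) [Fact p.Prime],
          ClassX11a W p → ¬ Surj W p → 5 ≤ p → ¬ W.HasSplitMultiplicativeReductionAtPrime p →
          (∃ t : ℚ, W.entireLFunction 1 / (W.realPeriodRat : ℂ) = (t : ℂ) ∧ padicValRat p t = 0) →
          MissingUpperBoundAt W p) ∧
        (∀ (W : WeierstrassCurve ℚ) [W.IsElliptic] [W.IsGloballyMinimal] (p : ℕ) [Fact p.Prime],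
          ClassX11a W p → ¬ Surj W p → 5 ≤ p → (∀ (ℓ : ℕ) [Fact ℓ.Prime], ¬ W.HasSplitMultiplicativeReductionAtPrime ℓ) →
          (∀ x : W.sha, (p : ℤ) • x = 0 → x = 0) → MissingUpperBoundAt W p) ∧
        (∀ (W : WeierstrassCurve ℚ) [W.IsElliptic] [W.IsGloballyMinimal] (p : ℕ) [Fact p.Prime],
          ClassX11a W p → ¬ Surj W p → 5 ≤ p → (∀ (ℓ : ℕ) [Fact ℓ.Prime], ¬ W.HasSplitMultiplicativeReductionAtPrime ℓ) →
          (∃ x : W.sha, (p : ℤ) • x = 0 ∧ x ≠ 0) →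
          (∀ t : ℚ, W.entireLFunction 1 / (W.realPeriodRat : ℂ) = (t : ℂ) → padicValRat p t ≠ 0) →
          MissingUpperBoundAt W p) ∧
        (∀ (W : WeierstrassCurve ℚ) [W.IsElliptic] [W.IsGloballyMinimal] (p : ℕ) [Fact p.Prime],
          ClassX11a W p → ¬ Surj W p → 5 ≤ p →
          (∃ (ℓ : ℕ) (_ : Fact ℓ.Prime), W.HasSplitMultiplicativeReductionAtPrime ℓ) →
          (W.HasSplitMultiplicativeReductionAtPrime p ∨
            ∀ t : ℚ, W.entireLFunction 1 / (W.realPeriodRat : ℂ) = (t : ℂ) → padicValRat p t ≠ 0) →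
          MissingUpperBoundAt W p)) :=
  ⟨fun h => ⟨unitSector_of_upperNonSurjFive h, fun W _ _ p _ hX hns hp5 _ _ => h W p hX hns hp5,
      pTorsionCore_of_upperNonSurjFive h, splitMultCore_of_upperNonSurjFive h⟩,
    fun h => upperNonSurjFive_of_unitSector_of_sector_of_coreResiduals h.1 h.2.1 h.2.2.1 h.2.2.2⟩

/-- **Rev 8 ⇒ cores (weakening, fact-free):** the registered arithmetic residuals R′ (exponent term) and R₁′ (Tamagawa term) of
`Cruxes/UpperNonSurjFive/Lines/gl1cartan5.lean` rev 8 imply their non-unit cores R′♭ and R₁′♭ (each core carries one more hypothesis).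
[cite: Miller2011LMS, Def. 1.1] -/
theorem coreResiduals_of_arithResiduals
    (hR' : ∀ (W : WeierstrassCurve ℚ) [W.IsElliptic] [W.IsGloballyMinimal] (p : ℕ) [Fact p.Prime],
      ClassX11a W p → ¬ Surj W p → 5 ≤ p → (∀ (ℓ : ℕ) [Fact ℓ.Prime], ¬ W.HasSplitMultiplicativeReductionAtPrime ℓ) →
      (∃ x : W.sha, (p : ℤ) • x = 0 ∧ x ≠ 0) → MissingUpperBoundAt W p)
    (hR₁' : ∀ (W : WeierstrassCurve ℚ) [W.IsElliptic] [W.IsGloballyMinimal] (p : ℕ) [Fact p.Prime],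
      ClassX11a W p → ¬ Surj W p → 5 ≤ p →
      (∃ (ℓ : ℕ) (_ : Fact ℓ.Prime), W.HasSplitMultiplicativeReductionAtPrime ℓ) → MissingUpperBoundAt W p) :
    (∀ (W : WeierstrassCurve ℚ) [W.IsElliptic] [W.IsGloballyMinimal] (p : ℕ) [Fact p.Prime],
        ClassX11a W p → ¬ Surj W p → 5 ≤ p → (∀ (ℓ : ℕ) [Fact ℓ.Prime], ¬ W.HasSplitMultiplicativeReductionAtPrime ℓ) →
        (∃ x : W.sha, (p : ℤ) • x = 0 ∧ x ≠ 0) →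
        (∀ t : ℚ, W.entireLFunction 1 / (W.realPeriodRat : ℂ) = (t : ℂ) → padicValRat p t ≠ 0) →
        MissingUpperBoundAt W p) ∧
      (∀ (W : WeierstrassCurve ℚ) [W.IsElliptic] [W.IsGloballyMinimal] (p : ℕ) [Fact p.Prime],
        ClassX11a W p → ¬ Surj W p → 5 ≤ p →
        (∃ (ℓ : ℕ) (_ : Fact ℓ.Prime), W.HasSplitMultiplicativeReductionAtPrime ℓ) →
        (W.HasSplitMultiplicativeReductionAtPrime p ∨
          ∀ t : ℚ, W.entireLFunction 1 / (W.realPeriodRat : ℂ) = (t : ℂ) → padicValRat p t ≠ 0) →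
        MissingUpperBoundAt W p) :=
  ⟨fun W _ _ p _ hX hns hp5 hnsm hSha _ => hR' W p hX hns hp5 hnsm hSha,
    fun W _ _ p _ hX hns hp5 hsm _ => hR₁' W p hX hns hp5 hsm⟩

/-- **Cores ⇒ rev 8 (modulo the nine facts):** the non-unit cores give U5 by `upperNonSurjFive_of_nineFacts_of_coreResiduals`, and U5
restricts to R′ and R₁′.  With `coreResiduals_of_arithResiduals`: the rev-8 and rev-9 cuts of item 20614 are EQUIVALENT modulo the nine
print facts; rev 9 has the larger proved part (the unit sector). [cite: Kato2004Asterisque, §17.13 (pp. 279–280)] [cite: Miller2011LMS, Def. 1.1] -/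
theorem arithResiduals_of_nineFacts_of_coreResiduals
    (hJs : thm61_splitMultiplicative) (hJn : thm61_nonsplitMultiplicative)
    (h12 : Kato2004.thm12_4) (hnf : exists_isNewformOf)
    (hns' : Kato2004.exists_multDivisibilityInputs_nonsplit_contra)
    (hsp' : Kato2004.exists_multDivisibilityInputs_split_contra)
    (hfine' : Kato2004.exists_multDivisibilityInputs_fine_contra) (hMz : mazur_not_dvd_maninConstant_of_odd)
    (hGZK : rank_eq_analyticRank_of_analyticRank_le_one)
    (hC' : ∀ (W : WeierstrassCurve ℚ) [W.IsElliptic] [W.IsGloballyMinimal] (p : ℕ) [Fact p.Prime],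
      ClassX11a W p → ¬ Surj W p → 5 ≤ p → (∀ (ℓ : ℕ) [Fact ℓ.Prime], ¬ W.HasSplitMultiplicativeReductionAtPrime ℓ) →
      (∃ x : W.sha, (p : ℤ) • x = 0 ∧ x ≠ 0) →
      (∀ t : ℚ, W.entireLFunction 1 / (W.realPeriodRat : ℂ) = (t : ℂ) → padicValRat p t ≠ 0) →
      MissingUpperBoundAt W p)
    (hC₁' : ∀ (W : WeierstrassCurve ℚ) [W.IsElliptic] [W.IsGloballyMinimal] (p : ℕ) [Fact p.Prime],
      ClassX11a W p → ¬ Surj W p → 5 ≤ p →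
      (∃ (ℓ : ℕ) (_ : Fact ℓ.Prime), W.HasSplitMultiplicativeReductionAtPrime ℓ) →
      (W.HasSplitMultiplicativeReductionAtPrime p ∨
        ∀ t : ℚ, W.entireLFunction 1 / (W.realPeriodRat : ℂ) = (t : ℂ) → padicValRat p t ≠ 0) →
      MissingUpperBoundAt W p) :
    (∀ (W : WeierstrassCurve ℚ) [W.IsElliptic] [W.IsGloballyMinimal] (p : ℕ) [Fact p.Prime],
        ClassX11a W p → ¬ Surj W p → 5 ≤ p → (∀ (ℓ : ℕ) [Fact ℓ.Prime], ¬ W.HasSplitMultiplicativeReductionAtPrime ℓ) →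
        (∃ x : W.sha, (p : ℤ) • x = 0 ∧ x ≠ 0) → MissingUpperBoundAt W p) ∧
      (∀ (W : WeierstrassCurve ℚ) [W.IsElliptic] [W.IsGloballyMinimal] (p : ℕ) [Fact p.Prime],
        ClassX11a W p → ¬ Surj W p → 5 ≤ p →
        (∃ (ℓ : ℕ) (_ : Fact ℓ.Prime), W.HasSplitMultiplicativeReductionAtPrime ℓ) → MissingUpperBoundAt W p) :=
  have hU : PrintX11a.UpperNonSurjFive :=
    upperNonSurjFive_of_nineFacts_of_coreResiduals hJs hJn h12 hnf hns' hsp' hfine' hMz hGZK hC' hC₁'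
  ⟨fun W _ _ p _ hX hns hp5 _ _ => hU W p hX hns hp5, fun W _ _ p _ hX hns hp5 _ => hU W p hX hns hp5⟩

/-- **Rung of line «finemu5» ⇒ cores (modulo the eight facts, Greenberg–Stevens at split `p`):** Greenberg's analytic `μ = 0` on
the hard sub-locus (`Theorems.X11aNonSurjMuAnHardFive`, the registered rung of the μ-line «finemu5»; OPEN) implies both non-unit cores —
pointwise: a member of R′♭ or R₁′♭ lies on the hard locus, where the rung is the `μ`-certificate at the pair and
`ClassX11a.missingUpperBoundAt_of_not_surj_of_muCert_contra` applies.  So the record line's residual asks NO MORE of the future than the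
μ-line's rung (x11a-p3 g6: rung + nine facts ⇒ U5), and strictly less: the cores quantify over hard-locus pairs only AND assume
`Ш(E)[p] ≠ 0` (resp. a split multiplicative prime) — on the hard-locus pairs with `Ш(E)[p] = 0` and no split multiplicative prime the
record needs no `μ`-statement (SECTOR′). [cite: GreenbergLNM1716, §1 Conj. 1.11 (p. 62)] [cite: Kato2004Asterisque, §17.13 (pp. 279–280)]
[cite: Kobayashi2006DocMath, Cor. 4.2 (p. 575)] -/
theorem coreResiduals_of_muAnHardFive_of_nineFacts (hH : X11aNonSurjMuAnHardFive)
    (hJs : thm61_splitMultiplicative) (hJn : thm61_nonsplitMultiplicative)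
    (hGS : ∀ (W : WeierstrassCurve ℚ) [W.IsElliptic] [W.IsGloballyMinimal] (p : ℕ) [Fact p.Prime],
      greenberg_stevens (W := W) (p := p))
    (h12 : Kato2004.thm12_4) (hnf : exists_isNewformOf)
    (hns' : Kato2004.exists_multDivisibilityInputs_nonsplit_contra)
    (hsp' : Kato2004.exists_multDivisibilityInputs_split_contra)
    (hfine' : Kato2004.exists_multDivisibilityInputs_fine_contra) (hMz : mazur_not_dvd_maninConstant_of_odd) :
    (∀ (W : WeierstrassCurve ℚ) [W.IsElliptic] [W.IsGloballyMinimal] (p : ℕ) [Fact p.Prime],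
        ClassX11a W p → ¬ Surj W p → 5 ≤ p → (∀ (ℓ : ℕ) [Fact ℓ.Prime], ¬ W.HasSplitMultiplicativeReductionAtPrime ℓ) →
        (∃ x : W.sha, (p : ℤ) • x = 0 ∧ x ≠ 0) →
        (∀ t : ℚ, W.entireLFunction 1 / (W.realPeriodRat : ℂ) = (t : ℂ) → padicValRat p t ≠ 0) →
        MissingUpperBoundAt W p) ∧
      (∀ (W : WeierstrassCurve ℚ) [W.IsElliptic] [W.IsGloballyMinimal] (p : ℕ) [Fact p.Prime],
        ClassX11a W p → ¬ Surj W p → 5 ≤ p →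
        (∃ (ℓ : ℕ) (_ : Fact ℓ.Prime), W.HasSplitMultiplicativeReductionAtPrime ℓ) →
        (W.HasSplitMultiplicativeReductionAtPrime p ∨
          ∀ t : ℚ, W.entireLFunction 1 / (W.realPeriodRat : ℂ) = (t : ℂ) → padicValRat p t ≠ 0) →
        MissingUpperBoundAt W p) := by
  refine ⟨fun W _ _ p _ hX hns hp5 hnsm _ hval => ?_, fun W _ _ p _ hX hns hp5 _ hhard => ?_⟩
  · exact hX.missingUpperBoundAt_of_not_surj_of_muCert_contra hJs hJn h12 hnf hns' hsp' hfine' hMz W p (fun _ => hGS W p) hns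
      (fun f hf ϖ hϖ a L hsa hna hL => hH W p hX hns hp5 (Or.inr hval) f hf ϖ hϖ a L hsa hna hL)
  · exact hX.missingUpperBoundAt_of_not_surj_of_muCert_contra hJs hJn h12 hnf hns' hsp' hfine' hMz W p (fun _ => hGS W p) hns
      (fun f hf ϖ hϖ a L hsa hna hL => hH W p hX hns hp5 hhard f hf ϖ hϖ a L hsa hna hL)

end Summit.BirchSwinnertonDyer.BirchSwinnertonDyer.Theorems.GL1Cartan

end
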